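import Mathlib
import Literature.Analysis.FluidPDE.SuitableWeak
import Literature.Analysis.FluidPDE.SelfSimilarCollapseAnsatz
import Literature.Analysis.FluidPDE.PoincareHomotopyOperatorL2
import HarnessLib

/-!
# Rung C1 of the crux `EulerZoomLiouville.PowerGaugeEulerLiouville`: the `D`-gauge (pressure) in
# profile variables for exactly self-similar members

Route №10 `EulerZoomLiouville` (NavierStokesRegularity), crux E = stmt-NavierStokesRegularity-19832,
tenure rung C1 (exactly self-similar members; window `0 < ρ ≤ 1/2`).  Companion of
`…SelfSimilarLEI.lean` (profile local energy inequality) and `…SelfSimilarGauges.lean` (`A`-gauge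
⇒ profile energy growth; transfer).  The refuter's reading of E (route №10, R2: "the `A`-gauge alone
is false on `(0, 1/2]`; the `a²`-long parabolic windows of the `E`- and `D`-gauges are load-bearing")
makes the pressure gauge part of any honest profile-side statement; this file translates it:

* `lintegral_ball_enorm_rpow_selfSimilarCollapsePressure` — exact scaling of
  `∫_{B_a} |p(τ)|^{3/2}` for `p = selfSimilarCollapsePressure γ 0 P`;
* `lintegral_Ioo_neg_rpow` — `∫_{(−m,0)} (−τ)^q dτ = m^{q+1}/(q+1)` (`q > −1`) in `ℝ≥0∞`;
* `profile_pressure_weight_of_gaugeD` — the `D`-GAUGE IN PROFILE VARIABLES: if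
  `a^{2ρ} D(a; 0; p) ≤ c` for all `a > 0` (`D = cknD`, `0 < ρ < 1`, `γ = 1/(2+ρ)`), then
  `∫ |P(y)|^{3/2} |y|^{2ρ−2} dy ≤ ((2−2ρ)/(2+ρ)) · c`
  (Tonelli in `(τ, y)`: the time spent by the parabolic window `Q_a` over the profile point `y` is
  `∫_{(a/|y|)^{2+ρ} > −τ > 0} (−τ)^{6γ−3} dτ = (a/|y|)^{2−2ρ} (2+ρ)/(2−2ρ)` once `|y| ≥ a^{ρ/(2+ρ)}`,
  and `a ↓ 0` exhausts `y ≠ 0`).  At the endpoint `ρ = 1/2`: `∫ |P|^{3/2} |y|^{−1} ≤ (2/5) c`.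

WHAT THIS IS NOT: not NS, not E, not rung C1 — the pressure half of the dictionary that moves C1's
hypotheses to profile space.
-/

noncomputable section

set_option linter.dupNamespace false

open MeasureTheory Set Filter Topology Metric Function TopologicalSpace
open scoped ENNReal NNReal InnerProductSpace RealInnerProductSpace

namespace Summit.NavierStokesRegularity.NavierStokesRegularity.Theorems.PowerGaugeEulerLiouville

open Literature.Analysis Literature.Analysis.FunctionSpaces Literature.Analysis.FluidPDE

section GaugeD

/-- **Ball integrals of `|p|^{3/2}` for the pressure ansatz (exact scaling, `ℝ≥0∞`).**  For `τ < 0`: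
`∫_{B_a} |p(τ,x)|^{3/2} dx = (−τ)^{6γ−3} ∫_{B_{(−τ)^{−γ} a}} |P|^{3/2}` for
`p = selfSimilarCollapsePressure γ 0 P` (`|(−τ)^{2(γ−1)}|^{3/2} = (−τ)^{3γ−3}`, Jacobian
`(−τ)^{3γ}`). [folklore] -/
theorem lintegral_ball_enorm_rpow_selfSimilarCollapsePressure (γ : ℝ) {τ : ℝ} (hτ : τ < 0)
    (P : EuclideanSpace ℝ (Fin 3) → ℝ) (a : ℝ) :
    ∫⁻ x in ball (0 : EuclideanSpace ℝ (Fin 3)) a,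
        ‖selfSimilarCollapsePressure γ 0 P τ x‖ₑ ^ (3 / 2 : ℝ) =
      ENNReal.ofReal ((-τ) ^ (6 * γ - 3)) *
        ∫⁻ y in ball (0 : EuclideanSpace ℝ (Fin 3)) ((-τ) ^ (-γ) * a), ‖P y‖ₑ ^ (3 / 2 : ℝ) := by
  have hs : 0 < -τ := neg_pos.2 hτ
  have ht : 0 < (-τ) ^ (-γ) := Real.rpow_pos_of_pos hs _
  have h1 : ∀ x, ‖selfSimilarCollapsePressure γ 0 P τ x‖ₑ ^ (3 / 2 : ℝ) =
      ENNReal.ofReal ((-τ) ^ (3 * (γ - 1))) * ‖P ((-τ) ^ (-γ) • x)‖ₑ ^ (3 / 2 : ℝ) := by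
    intro x
    rw [selfSimilarCollapsePressure_apply, zero_sub, enorm_mul, ENNReal.mul_rpow_of_nonneg _ _ (by norm_num),
      Real.enorm_eq_ofReal (Real.rpow_nonneg hs.le _), ENNReal.ofReal_rpow_of_nonneg (Real.rpow_nonneg hs.le _)
        (by norm_num), ← Real.rpow_mul hs.le]
    congr 3
    ring
  simp_rw [h1]
  rw [lintegral_const_mul' _ _ ENNReal.ofReal_ne_top,
    lintegral_ball_comp_smul (fun y => ‖P y‖ₑ ^ (3 / 2 : ℝ)) ht a, ← mul_assoc,
    ← ENNReal.ofReal_mul (Real.rpow_nonneg hs.le _)]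
  congr 2
  rw [← Real.rpow_natCast ((-τ) ^ (-γ)) 3, ← Real.rpow_mul hs.le, ← Real.rpow_neg hs.le,
    ← Real.rpow_add hs]
  congr 1
  push_cast
  ring

/-- `∫_{(−m, 0)} (−τ)^q dτ = m^{q+1}/(q+1)` for `q > −1`, `m > 0`, as a lower Lebesgue integral. [folklore] -/
theorem lintegral_Ioo_neg_rpow {q m : ℝ} (hq : -1 < q) (hm : 0 < m) :
    ∫⁻ τ in Ioo (-m) 0, ENNReal.ofReal ((-τ) ^ q) = ENNReal.ofReal (m ^ (q + 1) / (q + 1)) := by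
  have hI0 : IntegrableOn (fun s : ℝ => s ^ q) (Ioo 0 m) volume :=
    (intervalIntegral.intervalIntegrable_rpow' hq (a := 0) (b := m)).1.mono_set Ioo_subset_Ioc_self
  have hI : IntegrableOn (fun τ : ℝ => (-τ) ^ q) (Ioo (-m) 0) volume := by
    have h := ((MeasurePreserving.integrableOn_comp_preimage
      (Measure.measurePreserving_neg (volume : Measure ℝ))
      (Homeomorph.neg ℝ).measurableEmbedding).2 hI0)
    have hpre : (Neg.neg ⁻¹' Ioo (0 : ℝ) m) = Ioo (-m) 0 := by
      ext τ
      simp only [mem_preimage, mem_Ioo]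
      constructor
      · rintro ⟨h1, h2⟩; exact ⟨by linarith, by linarith⟩
      · rintro ⟨h1, h2⟩; exact ⟨by linarith, by linarith⟩
    rw [hpre] at h
    exact h
  rw [← ofReal_integral_eq_lintegral_ofReal hI
    (ae_restrict_of_forall_mem measurableSet_Ioo fun τ hτ =>
      Real.rpow_nonneg (neg_nonneg.2 hτ.2.le) _)]
  congr 1
  rw [setIntegral_congr_set Ioo_ae_eq_Ioc, ← intervalIntegral.integral_of_le (by linarith),
    intervalIntegral.integral_comp_neg (fun s : ℝ => s ^ q), neg_zero, neg_neg,
    integral_rpow (Or.inl hq), Real.zero_rpow (by linarith), sub_zero]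

/-- **The pressure profile of an exactly self-similar member is a.e.-strongly measurable** (a
measurable slice undone by a dilation; twin of `aestronglyMeasurable_profile`). [folklore] -/
theorem aestronglyMeasurable_pressureProfile {γ : ℝ}
    {p : ℝ → EuclideanSpace ℝ (Fin 3) → ℝ} {P : EuclideanSpace ℝ (Fin 3) → ℝ}
    (hpm : AEStronglyMeasurable (uncurry p)
      (volume.restrict (Iio (0 : ℝ) ×ˢ (univ : Set (EuclideanSpace ℝ (Fin 3))))))
    (hp : ∀ τ : ℝ, τ < 0 → p τ = selfSimilarCollapsePressure γ 0 P τ) :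
    AEStronglyMeasurable P volume := by
  rw [Measure.volume_eq_prod, ← Measure.prod_restrict, Measure.restrict_univ] at hpm
  have h1 := hpm.prodMk_left
  haveI : (ae ((volume : Measure ℝ).restrict (Iio (0 : ℝ)))).NeBot := by
    rw [ae_neBot, Ne, Measure.restrict_eq_zero]
    simp
  have h2 : ∀ᵐ τ ∂((volume : Measure ℝ).restrict (Iio (0 : ℝ))), τ < 0 :=
    (ae_restrict_mem measurableSet_Iio)
  obtain ⟨τ₀, hτ₀m, hτ₀⟩ := (h1.and h2).exists
  have hs : 0 < -τ₀ := neg_pos.2 hτ₀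
  have hc : (-τ₀) ^ (2 * (γ - 1)) ≠ 0 := (Real.rpow_pos_of_pos hs _).ne'
  have hslice : AEStronglyMeasurable (fun x => (-τ₀) ^ (2 * (γ - 1)) * P ((-τ₀) ^ (-γ) • x)) volume := by
    have : (fun y => uncurry p (τ₀, y)) = fun x => (-τ₀) ^ (2 * (γ - 1)) * P ((-τ₀) ^ (-γ) • x) := by
      funext x
      simp only [uncurry, hp τ₀ hτ₀, selfSimilarCollapsePressure_apply, zero_sub]
    rw [← this]; exact hτ₀m
  have hPd : AEStronglyMeasurable (fun x => P ((-τ₀) ^ (-γ) • x)) volume := by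
    have heq : (fun x => P ((-τ₀) ^ (-γ) • x)) =
        fun x => ((-τ₀) ^ (2 * (γ - 1)))⁻¹ * ((-τ₀) ^ (2 * (γ - 1)) * P ((-τ₀) ^ (-γ) • x)) := by
      funext x
      rw [← mul_assoc, inv_mul_cancel₀ hc, one_mul]
    rw [heq]
    exact hslice.const_mul _
  have hd : (-τ₀) ^ γ ≠ 0 := (Real.rpow_pos_of_pos hs _).ne'
  have hq : Measure.QuasiMeasurePreserving (fun x : EuclideanSpace ℝ (Fin 3) => (-τ₀) ^ γ • x) volume volume := by
    refine ⟨measurable_const_smul _, ?_⟩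
    rw [Measure.map_addHaar_smul volume hd]
    exact Measure.smul_absolutelyContinuous
  have key := hPd.comp_quasiMeasurePreserving hq
  have heq : ((fun x => P ((-τ₀) ^ (-γ) • x)) ∘ fun x : EuclideanSpace ℝ (Fin 3) => (-τ₀) ^ γ • x) = P := by
    funext x
    simp only [comp_apply, smul_smul, Real.rpow_neg hs.le, inv_mul_cancel₀ hd, one_smul]
  rwa [heq] at key

/-- **The `D`-gauge in profile variables.**  Let `p(τ) = selfSimilarCollapsePressure γ 0 P τ`
(`τ < 0`, `γ = 1/(2+ρ)`, `0 < ρ < 1`) be a.e.-strongly measurable on the slab, with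
`a^{2ρ} D(a; 0; p) ≤ c` for every `a > 0` (`D = cknD`, the scaled `L^{3/2}` pressure quantity on the
parabolic window `(−a², 0) × B_a`).  Then the profile pressure carries the weighted bound
`∫ |P(y)|^{3/2} |y|^{2ρ−2} dy ≤ ((2−2ρ)/(2+ρ)) c`.  Proof: Tonelli in `(τ, y)` after the
self-similar change of variables; over a profile point `y` with `|y| ≥ a^{ρ/(2+ρ)}` the window spends
the time `∫_{0 < −τ < (a/|y|)^{2+ρ}} (−τ)^{6γ−3} dτ = ((2+ρ)/(2−2ρ)) (a/|y|)^{2−2ρ}`, all exponents of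
`a` cancel (`γ(2+ρ) = 1`), and `a ↓ 0` exhausts `y ≠ 0`. [folklore] -/
theorem profile_pressure_weight_of_gaugeD {ρ : ℝ} (hρ : 0 < ρ) (hρ1 : ρ < 1)
    {p : ℝ → EuclideanSpace ℝ (Fin 3) → ℝ} {P : EuclideanSpace ℝ (Fin 3) → ℝ} {c : ℝ≥0}
    (hpm : AEStronglyMeasurable (uncurry p)
      (volume.restrict (Iio (0 : ℝ) ×ˢ (univ : Set (EuclideanSpace ℝ (Fin 3))))))
    (hp : ∀ τ : ℝ, τ < 0 → p τ = selfSimilarCollapsePressure (1 / (2 + ρ)) 0 P τ)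
    (hD : ∀ a : ℝ, 0 < a →
      ENNReal.ofReal (a ^ (2 * ρ)) * cknD a (0 : ℝ × EuclideanSpace ℝ (Fin 3)) p ≤ (c : ℝ≥0∞)) :
    ∫⁻ y, ‖P y‖ₑ ^ (3 / 2 : ℝ) * ENNReal.ofReal (‖y‖ ^ (2 * ρ - 2)) ≤
      ENNReal.ofReal ((2 - 2 * ρ) / (2 + ρ)) * (c : ℝ≥0∞) := by
  set γ : ℝ := 1 / (2 + ρ) with hγ
  have h2ρ : 0 < 2 + ρ := by linarith
  have hγρ : γ * (2 + ρ) = 1 := by rw [hγ]; field_simp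
  have hγ0 : 0 < γ := by rw [hγ]; positivity
  set κ : ℝ := 6 * γ - 2 with hκdef
  have hκ : κ = (2 - 2 * ρ) / (2 + ρ) := by
    rw [hκdef, hγ]; field_simp; ring
  have hκ0 : 0 < κ := by rw [hκ]; exact div_pos (by linarith) h2ρ
  have hq : -1 < 6 * γ - 3 := by linarith
  have hPm : AEStronglyMeasurable P volume := aestronglyMeasurable_pressureProfile hpm hp
  -- the weighted integrand
  set w : EuclideanSpace ℝ (Fin 3) → ℝ≥0∞ :=
    fun y => ‖P y‖ₑ ^ (3 / 2 : ℝ) * ENNReal.ofReal (‖y‖ ^ (2 * ρ - 2)) with hw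
  -- STEP 1: for every `a > 0`, the bound on the region `‖y‖ ≥ a^{ργ}`
  have step : ∀ a : ℝ, 0 < a →
      ∫⁻ y in {y : EuclideanSpace ℝ (Fin 3) | a ^ (ρ * γ) ≤ ‖y‖}, w y ≤
        ENNReal.ofReal κ * (c : ℝ≥0∞) := by
    intro a ha
    -- (1a) the gauge: `X := ∫∫_{Q_a} |p|^{3/2} ≤ a^{2−2ρ} c`
    set X : ℝ≥0∞ := ∫⁻ q in parabolicCylinder a (0 : ℝ × EuclideanSpace ℝ (Fin 3)),
      ‖p q.1 q.2‖ₑ ^ (3 / 2 : ℝ) with hX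
    have hXle : X ≤ ENNReal.ofReal (a ^ (2 - 2 * ρ)) * (c : ℝ≥0∞) := by
      have h1 := hD a ha
      unfold cknD at h1
      have hA0 : ENNReal.ofReal a ^ 2 ≠ 0 := pow_ne_zero _ (by rw [ENNReal.ofReal_ne_zero_iff]; exact ha)
      have hAtop : ENNReal.ofReal a ^ 2 ≠ ⊤ := ENNReal.pow_ne_top ENNReal.ofReal_ne_top
      have hB0 : ENNReal.ofReal (a ^ (2 * ρ)) ≠ 0 := by
        rw [ENNReal.ofReal_ne_zero_iff]; exact Real.rpow_pos_of_pos ha _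
      have key : X = ENNReal.ofReal a ^ 2 * (ENNReal.ofReal (a ^ (2 * ρ)))⁻¹ *
          (ENNReal.ofReal (a ^ (2 * ρ)) * ((ENNReal.ofReal a ^ 2)⁻¹ * X)) := by
        rw [← mul_assoc, mul_assoc (ENNReal.ofReal a ^ 2), ENNReal.inv_mul_cancel hB0 ENNReal.ofReal_ne_top,
          mul_one, ← mul_assoc, ENNReal.mul_inv_cancel hA0 hAtop, one_mul]
      calc X = _ := key
        _ ≤ ENNReal.ofReal a ^ 2 * (ENNReal.ofReal (a ^ (2 * ρ)))⁻¹ * (c : ℝ≥0∞) := by gcongr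
        _ = ENNReal.ofReal (a ^ (2 - 2 * ρ)) * (c : ℝ≥0∞) := by
            rw [← ENNReal.ofReal_inv_of_pos (Real.rpow_pos_of_pos ha _), ← ENNReal.ofReal_pow ha.le,
              ← ENNReal.ofReal_mul (by positivity)]
            congr 2
            rw [Real.rpow_sub ha, Real.rpow_two, div_eq_mul_inv]
    -- (1b) Tonelli on `Q_a = (−a², 0) × B_a` and the slice scaling
    have hpmQ : AEMeasurable (fun q : ℝ × EuclideanSpace ℝ (Fin 3) => ‖p q.1 q.2‖ₑ ^ (3 / 2 : ℝ))
        (((volume : Measure ℝ).restrict (Ioo (-(a ^ 2)) 0)).prod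
          ((volume : Measure (EuclideanSpace ℝ (Fin 3))).restrict (ball 0 a))) := by
      have hsub : Ioo (-(a ^ 2)) 0 ×ˢ ball (0 : EuclideanSpace ℝ (Fin 3)) a ⊆
          Iio (0 : ℝ) ×ˢ (univ : Set (EuclideanSpace ℝ (Fin 3))) :=
        prod_mono (fun t ht => ht.2) (subset_univ _)
      have := (hpm.mono_measure (Measure.restrict_mono hsub le_rfl)).enorm.pow_const (3 / 2 : ℝ)
      rwa [Measure.volume_eq_prod, ← Measure.prod_restrict] at this
    have hXeq : X = ∫⁻ τ in Ioo (-(a ^ 2)) 0, ENNReal.ofReal ((-τ) ^ (6 * γ - 3)) *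
        ∫⁻ y in ball (0 : EuclideanSpace ℝ (Fin 3)) ((-τ) ^ (-γ) * a), ‖P y‖ₑ ^ (3 / 2 : ℝ) := by
      rw [hX]
      unfold parabolicCylinder
      rw [Prod.fst_zero, Prod.snd_zero, zero_sub, Measure.volume_eq_prod, ← Measure.prod_restrict,
        lintegral_prod _ hpmQ]
      refine setLIntegral_congr_fun measurableSet_Ioo fun τ hτ => ?_
      have key := lintegral_ball_enorm_rpow_selfSimilarCollapsePressure γ hτ.2 P a
      rw [← hp τ hτ.2] at key
      simpa using key
    -- (1c) swap the integrals
    set g : ℝ → EuclideanSpace ℝ (Fin 3) → ℝ≥0∞ := fun τ y =>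
      ENNReal.ofReal ((-τ) ^ (6 * γ - 3)) *
        {z : ℝ × EuclideanSpace ℝ (Fin 3) | ‖z.2‖ < (-z.1) ^ (-γ) * a}.indicator
          (fun z => ‖P z.2‖ₑ ^ (3 / 2 : ℝ)) (τ, y) with hg
    have hS : MeasurableSet {z : ℝ × EuclideanSpace ℝ (Fin 3) | ‖z.2‖ < (-z.1) ^ (-γ) * a} :=
      measurableSet_lt measurable_snd.norm ((measurable_fst.neg.pow_const _).mul_const a)
    have hgm : AEMeasurable (uncurry g)
        (((volume : Measure ℝ).restrict (Ioo (-(a ^ 2)) 0)).prod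
          (volume : Measure (EuclideanSpace ℝ (Fin 3)))) := by
      have h1 : Measurable fun z : ℝ × EuclideanSpace ℝ (Fin 3) => ENNReal.ofReal ((-z.1) ^ (6 * γ - 3)) :=
        (measurable_fst.neg.pow_const _).ennreal_ofReal
      have h2 : AEMeasurable (fun z : ℝ × EuclideanSpace ℝ (Fin 3) => ‖P z.2‖ₑ ^ (3 / 2 : ℝ))
          (((volume : Measure ℝ).restrict (Ioo (-(a ^ 2)) 0)).prod
            (volume : Measure (EuclideanSpace ℝ (Fin 3)))) :=
        (hPm.enorm.pow_const (3 / 2 : ℝ)).comp_snd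
      exact h1.aemeasurable.mul (h2.indicator hS)
    have hinner : ∀ τ : ℝ, τ ∈ Ioo (-(a ^ 2)) 0 →
        ENNReal.ofReal ((-τ) ^ (6 * γ - 3)) *
          ∫⁻ y in ball (0 : EuclideanSpace ℝ (Fin 3)) ((-τ) ^ (-γ) * a), ‖P y‖ₑ ^ (3 / 2 : ℝ) =
        ∫⁻ y, g τ y := by
      intro τ hτ
      rw [hg]
      simp only
      rw [lintegral_const_mul' _ _ ENNReal.ofReal_ne_top, ← lintegral_indicator measurableSet_ball]
      congr 1
      refine lintegral_congr fun y => ?_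
      simp only [indicator, mem_ball, dist_zero_right, mem_setOf_eq]
    have hXswap : X = ∫⁻ y, ∫⁻ τ in Ioo (-(a ^ 2)) 0, g τ y := by
      rw [hXeq, setLIntegral_congr_fun measurableSet_Ioo hinner, lintegral_lintegral_swap hgm]
    -- (1d) lower bound for the time integral over a profile point `y` with `‖y‖ ≥ a^{ργ}`
    have hlow : ∀ y : EuclideanSpace ℝ (Fin 3), a ^ (ρ * γ) ≤ ‖y‖ →
        ENNReal.ofReal (a ^ (2 - 2 * ρ) / κ) * w y ≤ ∫⁻ τ in Ioo (-(a ^ 2)) 0, g τ y := by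
      intro y hy
      have hy0 : 0 < ‖y‖ := lt_of_lt_of_le (Real.rpow_pos_of_pos ha _) hy
      set m : ℝ := (a / ‖y‖) ^ (2 + ρ) with hm
      have hm0 : 0 < m := Real.rpow_pos_of_pos (div_pos ha hy0) _
      -- `m ≤ a²`
      have hma : m ≤ a ^ 2 := by
        have h1 : a / ‖y‖ ≤ a ^ (1 - ρ * γ) := by
          rw [div_le_iff₀ hy0]
          calc a = a ^ (1 - ρ * γ) * a ^ (ρ * γ) := by
                rw [← Real.rpow_add ha]; norm_num
            _ ≤ a ^ (1 - ρ * γ) * ‖y‖ :=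
                mul_le_mul_of_nonneg_left hy (Real.rpow_nonneg ha.le _)
        calc m = (a / ‖y‖) ^ (2 + ρ) := hm
          _ ≤ (a ^ (1 - ρ * γ)) ^ (2 + ρ) :=
              Real.rpow_le_rpow (div_pos ha hy0).le h1 h2ρ.le
          _ = a ^ 2 := by
              rw [← Real.rpow_mul ha.le, show (1 - ρ * γ) * (2 + ρ) = ((2 : ℕ) : ℝ) by
                push_cast; linear_combination (-ρ) * hγρ, Real.rpow_natCast]
      -- on `(−m, 0)` the indicator is `1`
      have hind : ∀ τ : ℝ, τ ∈ Ioo (-m) 0 → g τ y =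
          ENNReal.ofReal ((-τ) ^ (6 * γ - 3)) * ‖P y‖ₑ ^ (3 / 2 : ℝ) := by
        intro τ hτ
        have hs : 0 < -τ := neg_pos.2 hτ.2
        have hlt : ‖y‖ < (-τ) ^ (-γ) * a := by
          -- `−τ < m = (a/‖y‖)^{2+ρ}` ⇒ `(−τ)^γ < a/‖y‖`
          have h1 : (-τ) ^ γ < a / ‖y‖ := by
            have h2 : (-τ) ^ γ < m ^ γ := Real.rpow_lt_rpow hs.le (by linarith [hτ.1]) hγ0
            rw [hm, ← Real.rpow_mul (div_pos ha hy0).le, show (2 + ρ) * γ = 1 by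
              linear_combination hγρ, Real.rpow_one] at h2
            exact h2
          rw [lt_div_iff₀ hy0] at h1
          rw [Real.rpow_neg hs.le, ← div_eq_inv_mul, lt_div_iff₀ (Real.rpow_pos_of_pos hs _)]
          linarith [mul_comm ((-τ) ^ γ) ‖y‖]
        rw [hg]
        simp only [indicator_of_mem (show (τ, y) ∈ {z : ℝ × EuclideanSpace ℝ (Fin 3) |
          ‖z.2‖ < (-z.1) ^ (-γ) * a} from hlt)]
      calc ENNReal.ofReal (a ^ (2 - 2 * ρ) / κ) * w y
          = ENNReal.ofReal (m ^ (6 * γ - 3 + 1) / (6 * γ - 3 + 1)) *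
              (‖P y‖ₑ ^ (3 / 2 : ℝ)) := by
            rw [hw]
            simp only
            rw [mul_comm (‖P y‖ₑ ^ (3 / 2 : ℝ)), ← mul_assoc, ← ENNReal.ofReal_mul (by positivity)]
            congr 2
            -- `a^{2−2ρ}/κ · ‖y‖^{2ρ−2} = m^{κ}/κ`, `m^κ = (a/‖y‖)^{2−2ρ}`
            have hmk : m ^ (6 * γ - 3 + 1) = a ^ (2 - 2 * ρ) * ‖y‖ ^ (2 * ρ - 2) := by
              rw [hm, ← Real.rpow_mul (div_pos ha hy0).le,
                show (2 + ρ) * (6 * γ - 3 + 1) = 2 - 2 * ρ by linear_combination 6 * hγρ,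
                Real.div_rpow ha.le hy0.le, div_eq_mul_inv, ← Real.rpow_neg hy0.le]
              congr 2; ring
            rw [hmk, show (6 * γ - 3 + 1 : ℝ) = κ by rw [hκdef]; ring]
            ring
        _ = ∫⁻ τ in Ioo (-m) 0, ENNReal.ofReal ((-τ) ^ (6 * γ - 3)) * ‖P y‖ₑ ^ (3 / 2 : ℝ) := by
            rw [lintegral_mul_const' _ _ (by
              exact ENNReal.rpow_ne_top_of_nonneg (by norm_num) enorm_ne_top),
              lintegral_Ioo_neg_rpow hq hm0]
        _ = ∫⁻ τ in Ioo (-m) 0, g τ y := (setLIntegral_congr_fun measurableSet_Ioo hind).symm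
        _ ≤ ∫⁻ τ in Ioo (-(a ^ 2)) 0, g τ y :=
            lintegral_mono_set (Ioo_subset_Ioo (by linarith) le_rfl)
    -- (1e) assemble
    have hmeasR : MeasurableSet {y : EuclideanSpace ℝ (Fin 3) | a ^ (ρ * γ) ≤ ‖y‖} :=
      measurableSet_le measurable_const measurable_norm
    have h1 : ENNReal.ofReal (a ^ (2 - 2 * ρ) / κ) *
        ∫⁻ y in {y : EuclideanSpace ℝ (Fin 3) | a ^ (ρ * γ) ≤ ‖y‖}, w y ≤ X := by
      rw [← lintegral_const_mul' _ _ ENNReal.ofReal_ne_top, hXswap, ← lintegral_indicator hmeasR]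
      refine lintegral_mono fun y => ?_
      by_cases hy : y ∈ {y : EuclideanSpace ℝ (Fin 3) | a ^ (ρ * γ) ≤ ‖y‖}
      · rw [indicator_of_mem hy]; exact hlow y hy
      · rw [indicator_of_notMem hy]; exact zero_le
    have h2 := h1.trans hXle
    -- divide by `a^{2−2ρ}/κ`
    have hpos : 0 < a ^ (2 - 2 * ρ) / κ := div_pos (Real.rpow_pos_of_pos ha _) hκ0
    have hne : ENNReal.ofReal (a ^ (2 - 2 * ρ) / κ) ≠ 0 := by
      rw [ENNReal.ofReal_ne_zero_iff]; exact hpos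
    calc ∫⁻ y in {y : EuclideanSpace ℝ (Fin 3) | a ^ (ρ * γ) ≤ ‖y‖}, w y
        = (ENNReal.ofReal (a ^ (2 - 2 * ρ) / κ))⁻¹ * (ENNReal.ofReal (a ^ (2 - 2 * ρ) / κ) *
            ∫⁻ y in {y : EuclideanSpace ℝ (Fin 3) | a ^ (ρ * γ) ≤ ‖y‖}, w y) := by
          rw [← mul_assoc, ENNReal.inv_mul_cancel hne ENNReal.ofReal_ne_top, one_mul]
      _ ≤ (ENNReal.ofReal (a ^ (2 - 2 * ρ) / κ))⁻¹ * (ENNReal.ofReal (a ^ (2 - 2 * ρ)) * (c : ℝ≥0∞)) := by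
          gcongr
      _ = ENNReal.ofReal κ * (c : ℝ≥0∞) := by
          rw [← mul_assoc, ← ENNReal.ofReal_inv_of_pos hpos, ← ENNReal.ofReal_mul (by positivity)]
          congr 2
          field_simp
  -- STEP 2: exhaust `y ≠ 0` by `a = 1/(n+1) → 0`
  have hdir : Directed (· ⊆ ·) fun n : ℕ =>
      {y : EuclideanSpace ℝ (Fin 3) | (1 / ((n : ℝ) + 1)) ^ (ρ * γ) ≤ ‖y‖} := by
    refine Monotone.directed_le fun m n hmn y hy => ?_
    simp only [mem_setOf_eq] at hy ⊢
    refine le_trans ?_ hy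
    exact Real.rpow_le_rpow (by positivity)
      (one_div_le_one_div_of_le (by positivity) (by exact_mod_cast Nat.add_le_add_right hmn 1))
      (by positivity)
  have hU : (⋃ n : ℕ, {y : EuclideanSpace ℝ (Fin 3) | (1 / ((n : ℝ) + 1)) ^ (ρ * γ) ≤ ‖y‖}) =
      {y | y ≠ 0} := by
    ext y
    simp only [mem_iUnion, mem_setOf_eq, ne_eq]
    constructor
    · rintro ⟨n, hn⟩ h0
      rw [h0, norm_zero] at hn
      exact not_lt.2 hn (Real.rpow_pos_of_pos (by positivity) _)
    · intro hy
      have hy0 : 0 < ‖y‖ := norm_pos_iff.2 hy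
      -- `(1/(n+1))^{ργ} → 0`
      have ht : Tendsto (fun n : ℕ => (1 / ((n : ℝ) + 1)) ^ (ρ * γ)) atTop (𝓝 0) := by
        have h0 : Tendsto (fun n : ℕ => (1 / ((n : ℝ) + 1))) atTop (𝓝 0) :=
          tendsto_one_div_add_atTop_nhds_zero_nat
        have := h0.rpow_const (p := ρ * γ) (Or.inr (by positivity))
        simpa [Real.zero_rpow (by positivity : ρ * γ ≠ 0)] using this
      obtain ⟨n, hn⟩ := (ht.eventually (Iic_mem_nhds hy0)).exists
      exact ⟨n, hn⟩
  have hzero : ({y : EuclideanSpace ℝ (Fin 3) | y ≠ 0} : Set (EuclideanSpace ℝ (Fin 3))) =ᵐ[volume]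
      (univ : Set (EuclideanSpace ℝ (Fin 3))) := by
    rw [ae_eq_univ]
    have : ({y : EuclideanSpace ℝ (Fin 3) | y ≠ 0} : Set (EuclideanSpace ℝ (Fin 3)))ᶜ = {0} := by
      ext y; simp
    rw [this]
    exact measure_singleton 0
  calc ∫⁻ y, w y = ∫⁻ y in (univ : Set (EuclideanSpace ℝ (Fin 3))), w y := (setLIntegral_univ _).symm
    _ = ∫⁻ y in {y : EuclideanSpace ℝ (Fin 3) | y ≠ 0}, w y := (setLIntegral_congr hzero).symm
    _ = ⨆ n : ℕ, ∫⁻ y in {y : EuclideanSpace ℝ (Fin 3) | (1 / ((n : ℝ) + 1)) ^ (ρ * γ) ≤ ‖y‖}, w y := by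
        rw [← hU, setLIntegral_iUnion_of_directed _ hdir]
    _ ≤ ENNReal.ofReal κ * (c : ℝ≥0∞) := iSup_le fun n => step _ (by positivity)
    _ = ENNReal.ofReal ((2 - 2 * ρ) / (2 + ρ)) * (c : ℝ≥0∞) := by rw [hκ]

end GaugeD

end Summit.NavierStokesRegularity.NavierStokesRegularity.Theorems.PowerGaugeEulerLiouville
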